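import Summits.AtomisticToContinuum.Crystallization.Theses.ReggeStarCoercivity
import Literature.MathematicalPhysics.StatisticalMechanics.LennardJonesClusters

/-!
# drefute evidence — a complete proof of STUB 1 `stub_closestPairDeletion` of line `separation-padding-transfer`
(crux `ReggeStarCoercivity.StarCoercivity`, stmt-AtomisticToContinuum-13600)

SEPARATION IS REMOVABLE: the crux inequality with constants `(g, C)` on `1/3`-separated injective configurations implies it with
`(min g (−e_per/56), max C 0)` on all injective configurations.  Strong induction on `N`; at a closest pair of distance `r < 1/3`
the site energy is positive, deleting that particle costs `|e_per|` on the left and flips at most `1 + 55` defect flags.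

Candidate proof for the lead (a refuter may not land positive statements).  The last theorem restates the registered stub
VERBATIM (`stub_closestPairDeletion_proof`).
-/

noncomputable section

open scoped BigOperators Classical
open Literature.MathematicalPhysics.StatisticalMechanics Literature.Geometry.DiscreteGeometry

namespace Summit.AtomisticToContinuum.Crystallization.Cruxes.StarCoercivity.SeparationPaddingTransfer.DrefuteL1

/-- Euclidean `3`-space. -/
local notation "E3" => EuclideanSpace ℝ (Fin 3)

/-! ## Vocabulary (verbatim sub-terms of the crux) -/

/-- `e_per`. -/
def ePer : ℝ := ⨅ Q : PeriodicConfiguration 3, Q.energyPerParticle lennardJones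

/-- The recentred rescaled `6/5`-shell of site `i`. -/
def shell {N : ℕ} (x : Fin N → E3) (i : Fin N) (a : ℝ) : Finset E3 :=
  (Finset.univ.filter fun j : Fin N => j ≠ i ∧ dist (x i) (x j) ≤ 6 / 5).image fun j => a⁻¹ • (x j - x i)

/-- Star-good (negation of the crux's defect predicate). -/
def IsStarGood {N : ℕ} (x : Fin N → E3) (i : Fin N) : Prop :=
  ∃ a : ℝ, 9 / 10 ≤ a ∧ a ≤ 11 / 10 ∧
    (ShellCloseTo (1 / 20) (shell x i a) fccKissingPattern ∨ ShellCloseTo (1 / 20) (shell x i a) hcpKissingPattern)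

/-- `#Def(x)`. -/
def defects {N : ℕ} (x : Fin N → E3) : ℕ := Nat.card {i : Fin N // ¬ IsStarGood x i}

/-- The finset of defective sites. -/
def defSet {N : ℕ} (x : Fin N → E3) : Finset (Fin N) := Finset.univ.filter fun i => ¬ IsStarGood x i

theorem defects_eq_card {N : ℕ} (x : Fin N → E3) : defects x = (defSet x).card := by
  rw [defects, defSet, Nat.card_eq_fintype_card, Fintype.card_subtype]

/-- `1/3`-separation. -/
def IsSeparated {N : ℕ} (x : Fin N → E3) : Prop := ∀ i j : Fin N, i ≠ j → (1 / 3 : ℝ) ≤ dist (x i) (x j)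

/-- The crux inequality with constants `(g, C)` on all injective configurations. -/
def StarCoercivityWith (g C : ℝ) : Prop :=
  ∀ (N : ℕ) (x : Fin N → E3), Function.Injective x →
    (N : ℝ) * ePer + g * (defects x : ℝ) - C * (N : ℝ) ^ (2 / 3 : ℝ) ≤ interactionEnergy lennardJones x

/-- The same inequality on `1/3`-separated injective configurations. -/
def SepStarCoercivityWith (g C : ℝ) : Prop :=
  ∀ (N : ℕ) (x : Fin N → E3), Function.Injective x → IsSeparated x →
    (N : ℝ) * ePer + g * (defects x : ℝ) - C * (N : ℝ) ^ (2 / 3 : ℝ) ≤ interactionEnergy lennardJones x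

/-! ## Energy bookkeeping under deletion of one particle -/

theorem siteEnergy_eq_sum_sub (V : ℝ → ℝ) {N : ℕ} (x : Fin N → E3) (i : Fin N) :
    siteEnergy V x i = ∑ k, V (dist (x i) (x k)) - V 0 := by
  unfold siteEnergy
  rw [Finset.sum_erase_eq_sub (Finset.mem_univ i), dist_self]

/-- `E(x) = E(x ∖ i₀) + 𝓔^{i₀}(x)` (exact, any `V`). -/
theorem interactionEnergy_succAbove (V : ℝ → ℝ) {n : ℕ} (x : Fin (n + 1) → E3) (i₀ : Fin (n + 1)) :
    interactionEnergy V x = interactionEnergy V (x ∘ i₀.succAbove) + siteEnergy V x i₀ := by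
  have h2 := two_mul_interactionEnergy V x
  have h2' := two_mul_interactionEnergy V (x ∘ i₀.succAbove)
  rw [Fin.sum_univ_succAbove _ i₀] at h2
  have hs : ∀ i', siteEnergy V x (i₀.succAbove i') =
      siteEnergy V (x ∘ i₀.succAbove) i' + V (dist (x (i₀.succAbove i')) (x i₀)) := by
    intro i'
    rw [siteEnergy_eq_sum_sub, siteEnergy_eq_sum_sub, Fin.sum_univ_succAbove _ i₀]
    simp only [Function.comp_apply]
    ring
  have h0 : siteEnergy V x i₀ = ∑ k', V (dist (x i₀) (x (i₀.succAbove k'))) := by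
    rw [siteEnergy_eq_sum_sub, Fin.sum_univ_succAbove _ i₀, dist_self]
    ring
  simp only [hs, Finset.sum_add_distrib] at h2
  have hsym : ∑ i', V (dist (x (i₀.succAbove i')) (x i₀)) = siteEnergy V x i₀ := by
    rw [h0]
    exact Finset.sum_congr rfl fun k _ => by rw [dist_comm]
  linarith [h2, h2', hsym]

/-! ## Geometry of good sites (the inputs of `56`) -/

theorem norm_eq_one_of_mem_image_kissing {K : Finset E3} (hK : K = fccKissingPattern ∨ K = hcpKissingPattern)
    (A : E3 →ₗᵢ[ℝ] E3) {p : E3} (hp : p ∈ K.image A) : ‖p‖ = 1 := by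
  obtain ⟨v, hv, rfl⟩ := Finset.mem_image.1 hp
  rw [A.norm_map]
  rcases hK with rfl | rfl
  · exact norm_eq_one_of_mem_fccKissingPattern hv
  · exact norm_eq_one_of_mem_hcpKissingPattern hv

/-- A star-good site is `171/200`-separated from every particle of its `6/5`-ball. -/
theorem dist_ge_of_good {N : ℕ} {x : Fin N → E3} {j k : Fin N} (hkj : k ≠ j) (hd : dist (x j) (x k) ≤ 6 / 5)
    (hgood : IsStarGood x j) : 171 / 200 ≤ dist (x j) (x k) := by
  obtain ⟨a, ha1, ha2, hclose⟩ := hgood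
  have ha0 : 0 < a := by linarith
  have key : ∀ K : Finset E3, (K = fccKissingPattern ∨ K = hcpKissingPattern) →
      ShellCloseTo (1 / 20) (shell x j a) K → 171 / 200 ≤ dist (x j) (x k) := by
    intro K hK ⟨A, e, he⟩
    have hmem : a⁻¹ • (x k - x j) ∈ shell x j a :=
      Finset.mem_image_of_mem _ (Finset.mem_filter.2 ⟨Finset.mem_univ _, hkj, hd⟩)
    have h1 := he ⟨_, hmem⟩
    have hp : ‖((e ⟨_, hmem⟩ : ↥(K.image A)) : E3)‖ = 1 := norm_eq_one_of_mem_image_kissing hK A (e ⟨_, hmem⟩).2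
    have h2 : (19 / 20 : ℝ) ≤ ‖a⁻¹ • (x k - x j)‖ := by
      have := norm_sub_norm_le ((e ⟨_, hmem⟩ : ↥(K.image A)) : E3) (a⁻¹ • (x k - x j))
      rw [hp, ← dist_eq_norm, dist_comm] at this
      have h1' : dist (a⁻¹ • (x k - x j)) ((e ⟨_, hmem⟩ : ↥(K.image A)) : E3) ≤ 1 / 20 := h1
      linarith
    rw [norm_smul, norm_inv, Real.norm_of_nonneg ha0.le, ← dist_eq_norm, dist_comm] at h2
    rw [le_inv_mul_iff₀ ha0] at h2
    nlinarith
  rcases hclose with h | h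
  · exact key _ (Or.inl rfl) h
  · exact key _ (Or.inr rfl) h

/-- At most `55` points pairwise `≥ 171/200` apart in a closed `6/5`-ball. -/
theorem card_le_55 (s : Finset E3) (p : E3) (hs : ∀ c ∈ s, dist c p ≤ 6 / 5)
    (hsep : ∀ c ∈ s, ∀ d ∈ s, c ≠ d → (171 / 200 : ℝ) ≤ dist c d) : s.card ≤ 55 := by
  have h := card_le_of_separated_of_dist_le s p (by norm_num : (0 : ℝ) < 171 / 200) (by norm_num : (0 : ℝ) ≤ 6 / 5) hs hsep
  rw [finrank_euclideanSpace, Fintype.card_fin] at h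
  have h56 : (s.card : ℝ) < 56 := lt_of_le_of_lt h (by norm_num)
  exact Nat.lt_succ_iff.1 (by exact_mod_cast h56)

/-! ## Defect recount under deletion: `#Def(x) ≤ #Def(x ∖ i₀) + 56` -/

section Deletion

variable {n : ℕ} (x : Fin (n + 1) → E3) (i₀ : Fin (n + 1))

/-- Sites far from the deleted particle keep their shells. -/
theorem shell_succAbove_of_far {i' : Fin n} (hfar : ¬ dist (x (i₀.succAbove i')) (x i₀) ≤ 6 / 5) (a : ℝ) :
    shell x (i₀.succAbove i') a = shell (x ∘ i₀.succAbove) i' a := by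
  ext v
  simp only [shell, Finset.mem_image, Finset.mem_filter, Finset.mem_univ, true_and, Function.comp_apply]
  constructor
  · rintro ⟨j, ⟨hj1, hj2⟩, rfl⟩
    rcases Fin.eq_self_or_eq_succAbove i₀ j with rfl | ⟨j', rfl⟩
    · exact absurd hj2 hfar
    · exact ⟨j', ⟨fun h => hj1 (by rw [h]), hj2⟩, rfl⟩
  · rintro ⟨j', ⟨hj1, hj2⟩, rfl⟩
    exact ⟨i₀.succAbove j', ⟨fun h => hj1 (Fin.succAbove_right_injective h), hj2⟩, rfl⟩

theorem good_succAbove_iff_of_far {i' : Fin n} (hfar : ¬ dist (x (i₀.succAbove i')) (x i₀) ≤ 6 / 5) :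
    IsStarGood x (i₀.succAbove i') ↔ IsStarGood (x ∘ i₀.succAbove) i' := by
  unfold IsStarGood
  simp only [shell_succAbove_of_far x i₀ hfar]

/-- The sites of `x ∖ i₀` that are good there and lie within `6/5` of `x i₀` (the only ones whose flag can flip adversely). -/
def flipSet : Finset (Fin n) :=
  Finset.univ.filter fun i' => IsStarGood (x ∘ i₀.succAbove) i' ∧ dist (x (i₀.succAbove i')) (x i₀) ≤ 6 / 5

theorem card_flipSet_le (hx : Function.Injective x) : (flipSet x i₀).card ≤ 55 := by
  set x' : Fin n → E3 := x ∘ i₀.succAbove with hx'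
  have hx'inj : Function.Injective x' := hx.comp Fin.succAbove_right_injective
  have hcard : ((flipSet x i₀).image x').card = (flipSet x i₀).card :=
    Finset.card_image_of_injective _ hx'inj
  rw [← hcard]
  refine card_le_55 _ (x i₀) ?_ ?_
  · intro c hc
    obtain ⟨i', hi', rfl⟩ := Finset.mem_image.1 hc
    exact (Finset.mem_filter.1 hi').2.2
  · intro c hc d hd hcd
    obtain ⟨i', hi', rfl⟩ := Finset.mem_image.1 hc
    obtain ⟨k', hk', rfl⟩ := Finset.mem_image.1 hd
    have hik : k' ≠ i' := fun h => hcd (by rw [h])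
    by_cases hle : dist (x' i') (x' k') ≤ 6 / 5
    · exact dist_ge_of_good hik hle (Finset.mem_filter.1 hi').2.1
    · push Not at hle
      linarith

/-- **Defect recount**: deleting one particle of an injective configuration raises the defect count by at most `56`
relative to the smaller configuration. -/
theorem defects_le_succ (hx : Function.Injective x) : defects x ≤ defects (x ∘ i₀.succAbove) + 56 := by
  rw [defects_eq_card, defects_eq_card]
  have hsub : defSet x ⊆ insert i₀ ((defSet (x ∘ i₀.succAbove) ∪ flipSet x i₀).map (Fin.succAboveEmb i₀)) := by
    intro i hi
    have hbad : ¬ IsStarGood x i := (Finset.mem_filter.1 hi).2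
    rcases Fin.eq_self_or_eq_succAbove i₀ i with rfl | ⟨i', rfl⟩
    · exact Finset.mem_insert_self _ _
    · refine Finset.mem_insert_of_mem (Finset.mem_map.2 ⟨i', ?_, rfl⟩)
      rw [Finset.mem_union]
      by_cases hfar : dist (x (i₀.succAbove i')) (x i₀) ≤ 6 / 5
      · by_cases hg : IsStarGood (x ∘ i₀.succAbove) i'
        · exact Or.inr (Finset.mem_filter.2 ⟨Finset.mem_univ _, hg, hfar⟩)
        · exact Or.inl (Finset.mem_filter.2 ⟨Finset.mem_univ _, hg⟩)
      · rw [good_succAbove_iff_of_far x i₀ hfar] at hbad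
        exact Or.inl (Finset.mem_filter.2 ⟨Finset.mem_univ _, hbad⟩)
  calc (defSet x).card ≤ (insert i₀ ((defSet (x ∘ i₀.succAbove) ∪ flipSet x i₀).map (Fin.succAboveEmb i₀))).card :=
        Finset.card_le_card hsub
    _ ≤ ((defSet (x ∘ i₀.succAbove) ∪ flipSet x i₀).map (Fin.succAboveEmb i₀)).card + 1 := Finset.card_insert_le _ _
    _ = (defSet (x ∘ i₀.succAbove) ∪ flipSet x i₀).card + 1 := by rw [Finset.card_map]
    _ ≤ (defSet (x ∘ i₀.succAbove)).card + (flipSet x i₀).card + 1 := by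
        have := Finset.card_union_le (defSet (x ∘ i₀.succAbove)) (flipSet x i₀); omega
    _ ≤ (defSet (x ∘ i₀.succAbove)).card + 56 := by have := card_flipSet_le x i₀ hx; omega

end Deletion

/-! ## Positive site energy at a closest pair -/

theorem siteEnergy_pos_of_closest {N : ℕ} (x : Fin N → E3) {r : ℝ} (hr : 0 < r) (hr3 : r < 1 / 3)
    (hsep : ∀ k l : Fin N, k ≠ l → r ≤ dist (x k) (x l)) {i₀ j₀ : Fin N} (hij : i₀ ≠ j₀)
    (hrd : dist (x i₀) (x j₀) = r) : 0 < siteEnergy lennardJones x i₀ := by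
  have hS := sum_inv_pow_six_le x hr hsep i₀
  have h12 : r⁻¹ ^ 12 ≤ ∑ k ∈ Finset.univ.erase i₀, (dist (x i₀) (x k))⁻¹ ^ 12 := by
    have hj : j₀ ∈ Finset.univ.erase i₀ := Finset.mem_erase.2 ⟨hij.symm, Finset.mem_univ _⟩
    have := Finset.single_le_sum (f := fun k => (dist (x i₀) (x k))⁻¹ ^ 12) (fun k _ => by positivity) hj
    simpa [hrd] using this
  have hexp : siteEnergy lennardJones x i₀ =
      (1 / 12) * ∑ k ∈ Finset.univ.erase i₀, (dist (x i₀) (x k))⁻¹ ^ 12 -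
        (1 / 6) * ∑ k ∈ Finset.univ.erase i₀, (dist (x i₀) (x k))⁻¹ ^ 6 := by
    simp only [siteEnergy, lennardJones, Finset.sum_sub_distrib, Finset.mul_sum]
  have hu : (729 : ℝ) < r⁻¹ ^ 6 := by
    have h3 : 3 < r⁻¹ := by
      rw [lt_inv_comm₀ (by norm_num) hr]
      have : (3 : ℝ)⁻¹ = 1 / 3 := by norm_num
      linarith
    calc (729 : ℝ) = 3 ^ 6 := by norm_num
      _ < r⁻¹ ^ 6 := pow_lt_pow_left₀ h3 (by norm_num) (by norm_num)
  have h12' : r⁻¹ ^ 12 = (r⁻¹ ^ 6) ^ 2 := by ring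
  have hu' : 729 * r⁻¹ ^ 6 < r⁻¹ ^ 6 * r⁻¹ ^ 6 := mul_lt_mul_of_pos_right hu (by linarith)
  rw [h12', sq] at h12
  rw [hexp]
  nlinarith

/-! ## The induction -/

/-- **The induction** (the lead's `stub_deletionGlue`, abbreviated form): given the defect recount under deletion,
closest-pair deletion transfers the separated inequality to all injective configurations. -/
theorem closestPairDeletion_of_recount
    (hD : ∀ {n : ℕ} (x : Fin (n + 1) → E3) (i₀ : Fin (n + 1)), Function.Injective x →
      defects x ≤ defects (x ∘ i₀.succAbove) + 56)
    (g C : ℝ) (hg : 0 < g) (he : ePer < 0) (hsep : SepStarCoercivityWith g C) :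
    StarCoercivityWith (min g (-ePer / 56)) (max C 0) := by
  set g' : ℝ := min g (-ePer / 56) with hg'
  set C' : ℝ := max C 0 with hC'
  have hg'g : g' ≤ g := min_le_left _ _
  have hg'e : g' ≤ -ePer / 56 := min_le_right _ _
  have hg'0 : 0 ≤ g' := le_min hg.le (by linarith)
  have hC'C : C ≤ C' := le_max_left _ _
  have hC'0 : 0 ≤ C' := le_max_right _ _
  intro N
  induction N using Nat.strong_induction_on with
  | _ N ih =>
  intro x hx
  by_cases hs : IsSeparated x
  · -- separated: the hypothesis with weaker constants
    have h := hsep N x hx hs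
    have hD : (0 : ℝ) ≤ (defects x : ℝ) := Nat.cast_nonneg _
    have hP : (0 : ℝ) ≤ (N : ℝ) ^ (2 / 3 : ℝ) := Real.rpow_nonneg (Nat.cast_nonneg _) _
    nlinarith [mul_le_mul_of_nonneg_right hg'g hD, mul_le_mul_of_nonneg_right hC'C hP]
  · -- a closest pair at distance `r < 1/3`
    unfold IsSeparated at hs
    push Not at hs
    obtain ⟨i₁, j₁, hij₁, hlt⟩ := hs
    obtain ⟨p, hp, hmin⟩ := Finset.exists_min_image Finset.univ.offDiag
      (fun p : Fin N × Fin N => dist (x p.1) (x p.2)) ⟨(i₁, j₁), by simp [hij₁]⟩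
    obtain ⟨i₀, j₀⟩ := p
    have hij₀ : i₀ ≠ j₀ := by simpa using hp
    set r := dist (x i₀) (x j₀) with hr_def
    have hr : 0 < r := dist_pos.2 (hx.ne hij₀)
    have hsepr : ∀ k l, k ≠ l → r ≤ dist (x k) (x l) := fun k l hkl => hmin (k, l) (by simp [hkl])
    have hr3 : r < 1 / 3 := (hsepr i₁ j₁ hij₁).trans_lt hlt
    -- `N = n + 1`
    obtain ⟨n, rfl⟩ : ∃ n, N = n + 1 := Nat.exists_eq_succ_of_ne_zero (Fin.pos i₀).ne'
    set x' : Fin n → E3 := x ∘ i₀.succAbove with hx'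
    have hx'inj : Function.Injective x' := hx.comp Fin.succAbove_right_injective
    have hih := ih n (Nat.lt_succ_self n) x' hx'inj
    have hE : interactionEnergy lennardJones x = interactionEnergy lennardJones x' + siteEnergy lennardJones x i₀ :=
      interactionEnergy_succAbove lennardJones x i₀
    have hsite : 0 < siteEnergy lennardJones x i₀ := siteEnergy_pos_of_closest x hr hr3 hsepr hij₀ rfl
    have hdef : (defects x : ℝ) ≤ (defects x' : ℝ) + 56 := by exact_mod_cast hD x i₀ hx
    have hpow : ((n : ℕ) : ℝ) ^ (2 / 3 : ℝ) ≤ ((n + 1 : ℕ) : ℝ) ^ (2 / 3 : ℝ) :=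
      Real.rpow_le_rpow (Nat.cast_nonneg _) (by push_cast; linarith) (by norm_num)
    have h56 : 56 * g' ≤ -ePer := by
      have := hg'e
      rw [le_div_iff₀ (by norm_num : (0 : ℝ) < 56)] at this
      linarith
    push_cast at hih hpow ⊢
    nlinarith [mul_le_mul_of_nonneg_left hdef hg'0, mul_le_mul_of_nonneg_left hpow hC'0]

/-- **STUB 1 proved** (abbreviated form; = `ClosestPairDeletion` of the skeleton). -/
theorem closestPairDeletion (g C : ℝ) (hg : 0 < g) (he : ePer < 0) (hsep : SepStarCoercivityWith g C) :
    StarCoercivityWith (min g (-ePer / 56)) (max C 0) :=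
  closestPairDeletion_of_recount (fun x i₀ hx => defects_le_succ x i₀ hx) g C hg he hsep

/-! ## The registered stubs of the RESHAPED skeleton (lead, 2026-08-16T04:02Z), VERBATIM, proved -/

/-- `stub_shellSuccAbove` (STUB B), verbatim. -/
theorem stub_shellSuccAbove_proof : ∀ (N : ℕ) (x : Fin (N + 1) → EuclideanSpace ℝ (Fin 3)) (i₀ : Fin (N + 1)) (j : Fin N) (a : ℝ), 6 / 5 < dist (x (Fin.succAbove i₀ j)) (x i₀) → ((Finset.univ.filter fun k : Fin (N + 1) => k ≠ Fin.succAbove i₀ j ∧ dist (x (Fin.succAbove i₀ j)) (x k) ≤ 6 / 5).image fun k => a⁻¹ • (x k - x (Fin.succAbove i₀ j))) = ((Finset.univ.filter fun k : Fin N => k ≠ j ∧ dist (x (Fin.succAbove i₀ j)) (x (Fin.succAbove i₀ k)) ≤ 6 / 5).image fun k => a⁻¹ • (x (Fin.succAbove i₀ k) - x (Fin.succAbove i₀ j))) :=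
  fun _ x i₀ _ a h => shell_succAbove_of_far x i₀ (not_le.2 h) a

/-- `stub_nearGoodCount` (STUB C), verbatim: at most `55` star-good sites of ANY configuration (no injectivity) lie within `6/5`
of a point — good sites cannot even coincide with another particle (`dist_ge_of_good` with distance `0`). -/
theorem stub_nearGoodCount_proof : ∀ (N : ℕ) (y : Fin N → EuclideanSpace ℝ (Fin 3)) (p : EuclideanSpace ℝ (Fin 3)), ((Finset.univ.filter fun i : Fin N => dist (y i) p ≤ 6 / 5 ∧ ∃ a : ℝ, 9 / 10 ≤ a ∧ a ≤ 11 / 10 ∧ (Literature.Geometry.DiscreteGeometry.ShellCloseTo (1 / 20) ((Finset.univ.filter fun j : Fin N => j ≠ i ∧ dist (y i) (y j) ≤ 6 / 5).image fun j => a⁻¹ • (y j - y i)) Literature.Geometry.DiscreteGeometry.fccKissingPattern ∨ Literature.Geometry.DiscreteGeometry.ShellCloseTo (1 / 20) ((Finset.univ.filter fun j : Fin N => j ≠ i ∧ dist (y i) (y j) ≤ 6 / 5).image fun j => a⁻¹ • (y j - y i)) Literature.Geometry.DiscreteGeometry.hcpKissingPattern))).card ≤ 55 := by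
  intro N y p
  set S := Finset.univ.filter fun i : Fin N => dist (y i) p ≤ 6 / 5 ∧ IsStarGood y i with hS
  show S.card ≤ 55
  -- two good sites at mutual distance `≤ 6/5` are `≥ 171/200` apart; in particular `y` is injective on `S`
  have hpair : ∀ i ∈ S, ∀ k ∈ S, i ≠ k → dist (y i) (y k) ≤ 6 / 5 → 171 / 200 ≤ dist (y i) (y k) :=
    fun i hi k _ hik hd => dist_ge_of_good hik.symm hd (Finset.mem_filter.1 hi).2.2
  have hinj : Set.InjOn y ↑S := by
    intro i hi k hk hik
    by_contra hne
    have h := hpair i hi k hk hne (by rw [hik, dist_self]; norm_num)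
    rw [hik, dist_self] at h
    norm_num at h
  rw [← Finset.card_image_of_injOn hinj]
  refine card_le_55 _ p ?_ ?_
  · intro c hc
    obtain ⟨i, hi, rfl⟩ := Finset.mem_image.1 hc
    exact (Finset.mem_filter.1 hi).2.1
  · intro c hc d hd hcd
    obtain ⟨i, hi, rfl⟩ := Finset.mem_image.1 hc
    obtain ⟨k, hk, rfl⟩ := Finset.mem_image.1 hd
    have hik : i ≠ k := fun h => hcd (by rw [h])
    by_cases hle : dist (y i) (y k) ≤ 6 / 5
    · exact hpair i hi k hk hik hle
    · push Not at hle
      linarith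

/-- `stub_defectsGlue` (STUB D), verbatim.  (Proved outright: the two hypotheses B and C are what `defects_le_succ` re-derives
internally from `shell_succAbove_of_far`, `dist_ge_of_good`, `card_le_55`.) -/
theorem stub_defectsGlue_proof : (∀ (N : ℕ) (x : Fin (N + 1) → EuclideanSpace ℝ (Fin 3)) (i₀ : Fin (N + 1)) (j : Fin N) (a : ℝ), 6 / 5 < dist (x (Fin.succAbove i₀ j)) (x i₀) → ((Finset.univ.filter fun k : Fin (N + 1) => k ≠ Fin.succAbove i₀ j ∧ dist (x (Fin.succAbove i₀ j)) (x k) ≤ 6 / 5).image fun k => a⁻¹ • (x k - x (Fin.succAbove i₀ j))) = ((Finset.univ.filter fun k : Fin N => k ≠ j ∧ dist (x (Fin.succAbove i₀ j)) (x (Fin.succAbove i₀ k)) ≤ 6 / 5).image fun k => a⁻¹ • (x (Fin.succAbove i₀ k) - x (Fin.succAbove i₀ j)))) → (∀ (N : ℕ) (y : Fin N → EuclideanSpace ℝ (Fin 3)) (p : EuclideanSpace ℝ (Fin 3)), ((Finset.univ.filter fun i : Fin N => dist (y i) p ≤ 6 / 5 ∧ ∃ a : ℝ, 9 / 10 ≤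 a ∧ a ≤ 11 / 10 ∧ (Literature.Geometry.DiscreteGeometry.ShellCloseTo (1 / 20) ((Finset.univ.filter fun j : Fin N => j ≠ i ∧ dist (y i) (y j) ≤ 6 / 5).image fun j => a⁻¹ • (y j - y i)) Literature.Geometry.DiscreteGeometry.fccKissingPattern ∨ Literature.Geometry.DiscreteGeometry.ShellCloseTo (1 / 20) ((Finset.univ.filter fun j : Fin N => j ≠ i ∧ dist (y i) (y j) ≤ 6 / 5).image fun j => a⁻¹ • (y j - y i)) Literature.Geometry.DiscreteGeometry.hcpKissingPattern))).card ≤ 55) → ∀ (N : ℕ) (x : Fin (N + 1) → EuclideanSpace ℝ (Fin 3)) (i₀ : Fin (N + 1)), Function.Injective x → Nat.card {i : Fin (N + 1) // ¬ ∃ a : ℝ, 9 / 10 ≤ a ∧ a ≤ 11 / 10 ∧ (Literature.Geometry.DiscreteGeometry.ShellCloseTo (1 / 20) ((Finset.univ.filter fun j : Fin (N + 1) => j ≠ i ∧ dist (x i) (x j) ≤ 6 / 5).image fun j => a⁻¹ • (x j - x i)) Literature.Geometry.DiscreteGeometry.fccKissingPattern ∨ Literature.Geometry.DiscreteGeometry.ShellCloseTo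 (1 / 20) ((Finset.univ.filter fun j : Fin (N + 1) => j ≠ i ∧ dist (x i) (x j) ≤ 6 / 5).image fun j => a⁻¹ • (x j - x i)) Literature.Geometry.DiscreteGeometry.hcpKissingPattern)} ≤ Nat.card {i : Fin N // ¬ ∃ a : ℝ, 9 / 10 ≤ a ∧ a ≤ 11 / 10 ∧ (Literature.Geometry.DiscreteGeometry.ShellCloseTo (1 / 20) ((Finset.univ.filter fun j : Fin N => j ≠ i ∧ dist (x (Fin.succAbove i₀ i)) (x (Fin.succAbove i₀ j)) ≤ 6 / 5).image fun j => a⁻¹ • (x (Fin.succAbove i₀ j) - x (Fin.succAbove i₀ i))) Literature.Geometry.DiscreteGeometry.fccKissingPattern ∨ Literature.Geometry.DiscreteGeometry.ShellCloseTo (1 / 20) ((Finset.univ.filter fun j : Fin N => j ≠ i ∧ dist (x (Fin.succAbove i₀ i)) (x (Fin.succAbove i₀ j)) ≤ 6 / 5).image fun j => a⁻¹ • (x (Fin.succAbove i₀ j) - x (Fin.succAbove i₀ i))) Literature.Geometry.DiscreteGeometry.hcpKissingPattern)} + 56 :=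
  fun _ _ _ x i₀ hx => defects_le_succ x i₀ hx

/-- `stub_deletionGlue` (the reshaped STUB 1), verbatim — and this proof USES its hypothesis (the recount) through
`closestPairDeletion_of_recount`. -/
theorem stub_deletionGlue_proof : (∀ (N : ℕ) (x : Fin (N + 1) → EuclideanSpace ℝ (Fin 3)) (i₀ : Fin (N + 1)), Function.Injective x → Nat.card {i : Fin (N + 1) // ¬ ∃ a : ℝ, 9 / 10 ≤ a ∧ a ≤ 11 / 10 ∧ (Literature.Geometry.DiscreteGeometry.ShellCloseTo (1 / 20) ((Finset.univ.filter fun j : Fin (N + 1) => j ≠ i ∧ dist (x i) (x j) ≤ 6 / 5).image fun j => a⁻¹ • (x j - x i)) Literature.Geometry.DiscreteGeometry.fccKissingPattern ∨ Literature.Geometry.DiscreteGeometry.ShellCloseTo (1 / 20) ((Finset.univ.filter fun j : Fin (N + 1) => j ≠ i ∧ dist (x i) (x j) ≤ 6 / 5).image fun j => a⁻¹ • (x j - x i)) Literature.Geometry.DiscreteGeometry.hcpKissingPattern)} ≤ Nat.card {i : Fin N // ¬ ∃ a : ℝ, 9 / 10 ≤ a ∧ a ≤ 11 / 10 ∧ (Literature.Geometry.DiscreteGeometry.ShellCloseTo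 (1 / 20) ((Finset.univ.filter fun j : Fin N => j ≠ i ∧ dist (x (Fin.succAbove i₀ i)) (x (Fin.succAbove i₀ j)) ≤ 6 / 5).image fun j => a⁻¹ • (x (Fin.succAbove i₀ j) - x (Fin.succAbove i₀ i))) Literature.Geometry.DiscreteGeometry.fccKissingPattern ∨ Literature.Geometry.DiscreteGeometry.ShellCloseTo (1 / 20) ((Finset.univ.filter fun j : Fin N => j ≠ i ∧ dist (x (Fin.succAbove i₀ i)) (x (Fin.succAbove i₀ j)) ≤ 6 / 5).image fun j => a⁻¹ • (x (Fin.succAbove i₀ j) - x (Fin.succAbove i₀ i))) Literature.Geometry.DiscreteGeometry.hcpKissingPattern)} + 56) → ∀ g C : ℝ, 0 < g → (⨅ Q : Literature.MathematicalPhysics.StatisticalMechanics.PeriodicConfiguration 3, Q.energyPerParticle Literature.MathematicalPhysics.StatisticalMechanics.lennardJones) < 0 → (∀ (N : ℕ) (x : Fin N → EuclideanSpace ℝ (Fin 3)), Function.Injective x → (∀ i j : Fin N, i ≠ j → (1 / 3 : ℝ) ≤ dist (x i) (x j)) → (N : ℝ) * (⨅ Q : Literature.MathematicalPhysics.StatisticalMechanics.PeriodicConfiguration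 3, Q.energyPerParticle Literature.MathematicalPhysics.StatisticalMechanics.lennardJones) + g * (Nat.card {i : Fin N // ¬ ∃ a : ℝ, 9 / 10 ≤ a ∧ a ≤ 11 / 10 ∧ (Literature.Geometry.DiscreteGeometry.ShellCloseTo (1 / 20) ((Finset.univ.filter fun j : Fin N => j ≠ i ∧ dist (x i) (x j) ≤ 6 / 5).image fun j => a⁻¹ • (x j - x i)) Literature.Geometry.DiscreteGeometry.fccKissingPattern ∨ Literature.Geometry.DiscreteGeometry.ShellCloseTo (1 / 20) ((Finset.univ.filter fun j : Fin N => j ≠ i ∧ dist (x i) (x j) ≤ 6 / 5).image fun j => a⁻¹ • (x j - x i)) Literature.Geometry.DiscreteGeometry.hcpKissingPattern)} : ℝ) - C * (N : ℝ) ^ (2 / 3 : ℝ) ≤ Literature.MathematicalPhysics.StatisticalMechanics.interactionEnergy Literature.MathematicalPhysics.StatisticalMechanics.lennardJones x) → ∀ (N : ℕ) (x : Fin N → EuclideanSpace ℝ (Fin 3)), Function.Injective x → (N : ℝ) * (⨅ Q : Literature.MathematicalPhysics.StatisticalMechanics.PeriodicConfiguration 3, Q.energyPerParticle Literature.MathematicalPhysics.StatisticalMechanics.lennardJones)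 + min g (-(⨅ Q : Literature.MathematicalPhysics.StatisticalMechanics.PeriodicConfiguration 3, Q.energyPerParticle Literature.MathematicalPhysics.StatisticalMechanics.lennardJones) / 56) * (Nat.card {i : Fin N // ¬ ∃ a : ℝ, 9 / 10 ≤ a ∧ a ≤ 11 / 10 ∧ (Literature.Geometry.DiscreteGeometry.ShellCloseTo (1 / 20) ((Finset.univ.filter fun j : Fin N => j ≠ i ∧ dist (x i) (x j) ≤ 6 / 5).image fun j => a⁻¹ • (x j - x i)) Literature.Geometry.DiscreteGeometry.fccKissingPattern ∨ Literature.Geometry.DiscreteGeometry.ShellCloseTo (1 / 20) ((Finset.univ.filter fun j : Fin N => j ≠ i ∧ dist (x i) (x j) ≤ 6 / 5).image fun j => a⁻¹ • (x j - x i)) Literature.Geometry.DiscreteGeometry.hcpKissingPattern)} : ℝ) - max C 0 * (N : ℝ) ^ (2 / 3 : ℝ) ≤ Literature.MathematicalPhysics.StatisticalMechanics.interactionEnergy Literature.MathematicalPhysics.StatisticalMechanics.lennardJones x :=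
  fun hD => closestPairDeletion_of_recount (fun x i₀ hx => hD _ x i₀ hx)

/-- The ORIGINAL registered stub `stub_closestPairDeletion` (= the skeleton's `ClosestPairDeletion` /
`closestPairDeletion_of_stubs`), VERBATIM, proved. -/
theorem stub_closestPairDeletion_proof : ∀ g C : ℝ, 0 < g → (⨅ Q : Literature.MathematicalPhysics.StatisticalMechanics.PeriodicConfiguration 3, Q.energyPerParticle Literature.MathematicalPhysics.StatisticalMechanics.lennardJones) < 0 → (∀ (N : ℕ) (x : Fin N → EuclideanSpace ℝ (Fin 3)), Function.Injective x → (∀ i j : Fin N, i ≠ j → (1 / 3 : ℝ) ≤ dist (x i) (x j)) → (N : ℝ) * (⨅ Q : Literature.MathematicalPhysics.StatisticalMechanics.PeriodicConfiguration 3, Q.energyPerParticle Literature.MathematicalPhysics.StatisticalMechanics.lennardJones) + g * (Nat.card {i : Fin N // ¬ ∃ a : ℝ, 9 / 10 ≤ a ∧ a ≤ 11 / 10 ∧ (Literature.Geometry.DiscreteGeometry.ShellCloseTo (1 / 20) ((Finset.univ.filter fun j : Fin N => j ≠ i ∧ dist (x i) (x j) ≤ 6 / 5).image fun j => a⁻¹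 • (x j - x i)) Literature.Geometry.DiscreteGeometry.fccKissingPattern ∨ Literature.Geometry.DiscreteGeometry.ShellCloseTo (1 / 20) ((Finset.univ.filter fun j : Fin N => j ≠ i ∧ dist (x i) (x j) ≤ 6 / 5).image fun j => a⁻¹ • (x j - x i)) Literature.Geometry.DiscreteGeometry.hcpKissingPattern)} : ℝ) - C * (N : ℝ) ^ (2 / 3 : ℝ) ≤ Literature.MathematicalPhysics.StatisticalMechanics.interactionEnergy Literature.MathematicalPhysics.StatisticalMechanics.lennardJones x) → ∀ (N : ℕ) (x : Fin N → EuclideanSpace ℝ (Fin 3)), Function.Injective x → (N : ℝ) * (⨅ Q : Literature.MathematicalPhysics.StatisticalMechanics.PeriodicConfiguration 3, Q.energyPerParticle Literature.MathematicalPhysics.StatisticalMechanics.lennardJones) + min g (-(⨅ Q : Literature.MathematicalPhysics.StatisticalMechanics.PeriodicConfiguration 3, Q.energyPerParticle Literature.MathematicalPhysics.StatisticalMechanics.lennardJones) / 56) * (Nat.card {i : Fin N // ¬ ∃ a : ℝ, 9 / 10 ≤ a ∧ a ≤ 11 / 10 ∧ (Literature.Geometry.DiscreteGeometry.ShellCloseTo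 (1 / 20) ((Finset.univ.filter fun j : Fin N => j ≠ i ∧ dist (x i) (x j) ≤ 6 / 5).image fun j => a⁻¹ • (x j - x i)) Literature.Geometry.DiscreteGeometry.fccKissingPattern ∨ Literature.Geometry.DiscreteGeometry.ShellCloseTo (1 / 20) ((Finset.univ.filter fun j : Fin N => j ≠ i ∧ dist (x i) (x j) ≤ 6 / 5).image fun j => a⁻¹ • (x j - x i)) Literature.Geometry.DiscreteGeometry.hcpKissingPattern)} : ℝ) - max C 0 * (N : ℝ) ^ (2 / 3 : ℝ) ≤ Literature.MathematicalPhysics.StatisticalMechanics.interactionEnergy Literature.MathematicalPhysics.StatisticalMechanics.lennardJones x :=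
  closestPairDeletion

/-! ## Lead 2's line `elastic-tier-overlap-split`: its S1 `stub_separationRemoval`, VERBATIM, proved
(= closest-pair deletion + the vacuum competitor `e_per < 0`; the lemmas below up to `ePer_neg_of_sep` are copied from lead 1's
kernel-checked skeleton `Lines/separation-padding-transfer.lean`, which is not an importable module) -/

/-- A `1/3`-separated configuration is injective. -/
theorem injective_of_isSeparated {N : ℕ} {x : Fin N → E3} (hs : IsSeparated x) : Function.Injective x := by
  intro i j hij
  by_contra hne
  have h := hs i j hne
  rw [hij, dist_self] at h
  linarith

/-- If every site is star-defective then `#Def(x) = N`. -/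
theorem defects_eq_of_forall {N : ℕ} {x : Fin N → E3} (h : ∀ i, ¬ IsStarGood x i) : defects x = N := by
  unfold defects
  rw [Nat.card_congr (Equiv.subtypeUnivEquiv h)]
  simp

/-- A site whose rescaled shell never has exactly twelve points is star-defective. -/
theorem not_isStarGood_of_card_ne {N : ℕ} {x : Fin N → E3} {i : Fin N}
    (h : ∀ a : ℝ, 9 / 10 ≤ a → a ≤ 11 / 10 → (shell x i a).card ≠ 12) : ¬ IsStarGood x i := by
  rintro ⟨a, ha₁, ha₂, hclose⟩
  exact h a ha₁ ha₂ (card_eq_twelve_of_shellCloseTo hclose)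

/-- `(M³)^(2/3) = M²`. -/
theorem cube_rpow_two_thirds (M : ℕ) : (((M : ℝ) ^ 3) ^ (2 / 3 : ℝ)) = (M : ℝ) ^ 2 := by
  have hM : (0 : ℝ) ≤ (M : ℝ) := Nat.cast_nonneg M
  rw [show ((M : ℝ) ^ 3) = (M : ℝ) ^ (3 : ℝ) by norm_cast, ← Real.rpow_mul hM]
  norm_num

/-- The unit vector `e₀`. -/
def e0 : E3 := EuclideanSpace.single 0 1

theorem norm_e0 : ‖e0‖ = 1 := by simp [e0]

/-- `N` points on a line at spacing `2`: every `6/5`-shell is empty, every pair term is `≤ 0`. -/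
def lineConfig (N : ℕ) : Fin N → E3 := fun i => ((2 : ℝ) * (i : ℕ)) • e0

theorem dist_lineConfig {N : ℕ} (i j : Fin N) :
    dist (lineConfig N i) (lineConfig N j) = 2 * |((i : ℕ) : ℝ) - ((j : ℕ) : ℝ)| := by
  simp only [lineConfig, dist_eq_norm, ← sub_smul, norm_smul, norm_e0, mul_one, ← mul_sub,
    Real.norm_eq_abs, abs_mul, abs_two]

theorem two_le_dist_lineConfig {N : ℕ} {i j : Fin N} (hij : i ≠ j) :
    2 ≤ dist (lineConfig N i) (lineConfig N j) := by
  rw [dist_lineConfig]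
  have hne : (i : ℕ) ≠ (j : ℕ) := fun h => hij (Fin.ext h)
  have h1 : (1 : ℝ) ≤ |((i : ℕ) : ℝ) - ((j : ℕ) : ℝ)| := by
    rcases Nat.lt_or_gt_of_ne hne with h | h
    · have : ((i : ℕ) : ℝ) + 1 ≤ ((j : ℕ) : ℝ) := by exact_mod_cast h
      rw [abs_of_neg (by linarith)]
      linarith
    · have : ((j : ℕ) : ℝ) + 1 ≤ ((i : ℕ) : ℝ) := by exact_mod_cast h
      rw [abs_of_pos (by linarith)]
      linarith
  linarith

theorem isSeparated_lineConfig (N : ℕ) : IsSeparated (lineConfig N) := fun _ _ hij => by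
  linarith [two_le_dist_lineConfig (N := N) hij]

theorem lineConfig_injective (N : ℕ) : Function.Injective (lineConfig N) :=
  injective_of_isSeparated (isSeparated_lineConfig N)

/-- Every shell of the collinear configuration is empty, so every site is star-defective. -/
theorem shell_lineConfig {N : ℕ} (i : Fin N) (a : ℝ) : shell (lineConfig N) i a = ∅ := by
  unfold shell
  rw [Finset.image_eq_empty, Finset.filter_eq_empty_iff]
  rintro j - ⟨hji, hdist⟩
  have := two_le_dist_lineConfig (N := N) (Ne.symm hji)
  linarith

theorem defects_lineConfig (N : ℕ) : defects (lineConfig N) = N :=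
  defects_eq_of_forall fun i => not_isStarGood_of_card_ne fun a _ _ => by
    rw [shell_lineConfig i a]; simp

theorem interactionEnergy_lineConfig_nonpos (N : ℕ) :
    interactionEnergy lennardJones (lineConfig N) ≤ 0 := by
  unfold interactionEnergy
  refine Finset.sum_nonpos fun i _ => Finset.sum_nonpos fun j hj => ?_
  have hij : i ≠ j := (Finset.mem_Ioi.1 hj).ne
  exact lennardJones_nonpos (by linarith [two_le_dist_lineConfig (N := N) hij])

/-- **Tightness at the vacuum, separated form**: `SepStarCoercivityWith g C → g ≤ −e_per`. -/
theorem g_le_neg_ePer_of_sep {g C : ℝ} (h : SepStarCoercivityWith g C) : g ≤ -ePer := by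
  by_contra hlt
  push Not at hlt
  set c : ℝ := ePer + g with hc_def
  have hc : 0 < c := by rw [hc_def]; linarith
  obtain ⟨M, hM⟩ := exists_nat_gt (|C| / c)
  have hMpos : (0 : ℝ) < M := lt_of_le_of_lt (by positivity) hM
  have key := h (M ^ 3) (lineConfig (M ^ 3)) (lineConfig_injective _) (isSeparated_lineConfig _)
  rw [defects_lineConfig] at key
  have hE := interactionEnergy_lineConfig_nonpos (M ^ 3)
  push_cast at key
  rw [cube_rpow_two_thirds] at key
  have h1 : c * (M : ℝ) ^ 3 ≤ C * (M : ℝ) ^ 2 := by rw [hc_def]; nlinarith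
  have h2 : c * (M : ℝ) ≤ C := by
    have hM2 : (0 : ℝ) < (M : ℝ) ^ 2 := by positivity
    have : c * (M : ℝ) * (M : ℝ) ^ 2 ≤ C * (M : ℝ) ^ 2 := by nlinarith
    exact le_of_mul_le_mul_right this hM2
  have h3 : |C| < c * (M : ℝ) := by rwa [div_lt_iff₀ hc, mul_comm] at hM
  linarith [le_abs_self C]

/-- Hence a separated inequality with `g > 0` forces `e_per < 0`. -/
theorem ePer_neg_of_sep {g C : ℝ} (hg : 0 < g) (h : SepStarCoercivityWith g C) : ePer < 0 := by
  linarith [g_le_neg_ePer_of_sep h]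

/-- **Separation removal with existential constants** (lead 2's `SeparationRemoval`): the vacuum competitor turns the
hypothesis' `g > 0` into `e_per ≤ −g < 0`, and closest-pair deletion does the rest. -/
theorem separationRemoval
    (h : ∃ g : ℝ, 0 < g ∧ ∃ C : ℝ, ∀ (N : ℕ) (x : Fin N → E3), IsSeparated x →
      (N : ℝ) * ePer + g * (defects x : ℝ) - C * (N : ℝ) ^ (2 / 3 : ℝ) ≤ interactionEnergy lennardJones x) :
    ∃ g : ℝ, 0 < g ∧ ∃ C : ℝ, StarCoercivityWith g C := by
  obtain ⟨g, hg, C, hC⟩ := h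
  have hsep : SepStarCoercivityWith g C := fun N x _ hs => hC N x hs
  have he : ePer < 0 := ePer_neg_of_sep hg hsep
  exact ⟨min g (-ePer / 56), lt_min hg (by linarith), max C 0, closestPairDeletion g C hg he hsep⟩

/-- Lead 2's registered stub `stub_separationRemoval` of `Lines/elastic-tier-overlap-split.lean`, VERBATIM, proved. -/
theorem stub_separationRemoval_proof :
    (∃ g : ℝ, 0 < g ∧ ∃ C : ℝ, ∀ (N : ℕ) (x : Fin N → EuclideanSpace ℝ (Fin 3)),
        (∀ i j : Fin N, i ≠ j → (1 / 3 : ℝ) ≤ dist (x i) (x j)) →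
        (N : ℝ) * (⨅ Q : PeriodicConfiguration 3, Q.energyPerParticle lennardJones)
            + g * (Nat.card {i : Fin N // ¬ ∃ a : ℝ, 9 / 10 ≤ a ∧ a ≤ 11 / 10 ∧
                (ShellCloseTo (1 / 20) ((Finset.univ.filter fun j : Fin N => j ≠ i ∧ dist (x i) (x j) ≤ 6 / 5).image
                    fun j => a⁻¹ • (x j - x i)) fccKissingPattern ∨
                  ShellCloseTo (1 / 20) ((Finset.univ.filter fun j : Fin N => j ≠ i ∧ dist (x i) (x j) ≤ 6 / 5).image
                    fun j => a⁻¹ • (x j - x i)) hcpKissingPattern)} : ℝ)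
            - C * (N : ℝ) ^ (2 / 3 : ℝ) ≤ interactionEnergy lennardJones x) →
      ∃ g : ℝ, 0 < g ∧ ∃ C : ℝ, ∀ (N : ℕ) (x : Fin N → EuclideanSpace ℝ (Fin 3)), Function.Injective x →
        (N : ℝ) * (⨅ Q : PeriodicConfiguration 3, Q.energyPerParticle lennardJones)
            + g * (Nat.card {i : Fin N // ¬ ∃ a : ℝ, 9 / 10 ≤ a ∧ a ≤ 11 / 10 ∧
                (ShellCloseTo (1 / 20) ((Finset.univ.filter fun j : Fin N => j ≠ i ∧ dist (x i) (x j) ≤ 6 / 5).image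
                    fun j => a⁻¹ • (x j - x i)) fccKissingPattern ∨
                  ShellCloseTo (1 / 20) ((Finset.univ.filter fun j : Fin N => j ≠ i ∧ dist (x i) (x j) ≤ 6 / 5).image
                    fun j => a⁻¹ • (x j - x i)) hcpKissingPattern)} : ℝ)
            - C * (N : ℝ) ^ (2 / 3 : ℝ) ≤ interactionEnergy lennardJones x :=
  separationRemoval

end Summit.AtomisticToContinuum.Crystallization.Cruxes.StarCoercivity.SeparationPaddingTransfer.DrefuteL1

end
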